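import Literature.Computability.Cryptography.PeriodFindingBlocks
import HarnessLib

/-!
# The idealised shift-cell table: coins, defects, total variation, and reindexing by slices

Topic `Computability/Cryptography` (harmonic analysis of period finding); theorem-only file, no named facts.
Companion of `PeriodFindingBlocks.lean` (`sum_abs_corrMass_sub_le`: tables differing on a fraction `ε` of the register have
autocorrelation masses within `2Q²√(2ε)` in `ℓ¹`).

A table `F` on the register `[0, W·L·P)` (`v = v₀ + W L κ`, `v₀ = E + W j`, `E < W`, `j < L`, `κ < P`) that (ii) off a set
`Badκ` of COIN values `κ mod Kc` only depends on `v₀`, through a table `F₀`, and (iii) off a DEFECT set `D` of positions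
`v₀` is the shift-cell table `F₀(E + W j) = C_{cls E}((σ_E + j) mod S)` (`S ∣ L`), agrees with the IDEALISED table
`F₁(v) = C_{cls (v mod W)}((σ_{v mod W} + v / W) mod S)` except on the positions with a bad coin or a defect
(`ne_idealised_imp`); these number at most `(εκ + εD)·W L P` when `#Badκ ≤ εκ Kc`, `#D ≤ εD W L` (`card_ne_idealised_le`),
so the two autocorrelation laws are within `2√(2(εκ+εD))` (`sum_abs_corrMass_sub_idealised_le`). The idealised table is an
exact shift-cell table on every period (`idealised_shiftCell`). Finally, sums over the characters `c < a·N` of a weight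
vanishing off the multiples of `a` are sums over `k < N` (`sum_filter_range_mul_eq`), and sums over `k < S·W` split into
slices `k = k₀ + S ν` (`sum_filter_range_mul_eq_sum_sum`).

## References

* S. Hallgren, STOC 2005, §4. [Hallgren2005]
* P. W. Shor, SIAM J. Comput. 26 (1997), §5. [Shor1997]
-/

noncomputable section

namespace Literature.Computability.Cryptography

namespace PeriodFinding

open Finset
open scoped Classical

variable {Ω : Type*} [DecidableEq Ω]

/-! ### Counting positions by residue and by quotient -/

/-- At most `m · #D` numbers below `B·m` have their residue modulo `B` in `D`. [folklore] -/
theorem card_filter_mod_mem_le (B m : ℕ) (hB : 0 < B) (D : Finset ℕ) :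
    ((range (B * m)).filter (fun v => v % B ∈ D)).card ≤ m * D.card := by
  calc ((range (B * m)).filter (fun v => v % B ∈ D)).card
      ≤ ((D ×ˢ range m).image (fun p : ℕ × ℕ => p.1 + B * p.2)).card := by
        refine card_le_card fun v hv => ?_
        obtain ⟨hvr, hvD⟩ := mem_filter.1 hv
        refine mem_image.2 ⟨(v % B, v / B), mem_product.2 ⟨hvD, mem_range.2 ?_⟩, Nat.mod_add_div v B⟩
        exact (Nat.div_lt_iff_lt_mul hB).2 (by rw [mul_comm]; exact mem_range.1 hvr)
    _ ≤ (D ×ˢ range m).card := card_image_le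
    _ = m * D.card := by rw [card_product, card_range, mul_comm]

/-- The number of `v < B·m` whose quotient by `B` satisfies `P` is `B` times the number of `q < m` satisfying `P`.
[folklore] -/
theorem card_filter_div (B m : ℕ) (hB : 0 < B) (P : ℕ → Prop) [DecidablePred P] :
    ((range (B * m)).filter (fun v => P (v / B))).card = B * ((range m).filter P).card := by
  rw [card_filter, sum_range_mul_blocks B m, card_filter, mul_sum]
  refine sum_congr rfl fun q _ => ?_
  have : ∀ r ∈ range B, (if P ((r + B * q) / B) then 1 else 0) = if P q then 1 else 0 := by
    intro r hr
    rw [show (r + B * q) / B = q by rw [Nat.add_mul_div_left _ _ hB, Nat.div_eq_of_lt (mem_range.1 hr), zero_add]]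
  rw [sum_congr rfl this, sum_const, card_range, smul_eq_mul]

/-! ### The idealised table -/

section Ideal

variable {W L P Kc S : ℕ} (hW : 0 < W) (hL : 0 < L) (hSL : S ∣ L) (F F₀ : ℕ → Ω) (cls σ : ℕ → ℕ) (C : ℕ → ℕ → Ω)
  (Badκ D : Finset ℕ)
  (hcoin : ∀ v : ℕ, (v / (W * L)) % Kc ∉ Badκ → F v = F₀ (v % (W * L)))
  (hdef : ∀ E < W, ∀ j < L, E + W * j ∉ D → F₀ (E + W * j) = C (cls E) ((σ E + j) % S))

omit [DecidableEq Ω] in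
include hW hL hSL hcoin hdef in
/-- **Where the table differs from its idealisation there is a bad coin or a defect.** [cite: Hallgren2005, §4] -/
theorem ne_idealised_imp (v : ℕ) (hne : F v ≠ C (cls (v % W)) ((σ (v % W) + v / W) % S)) :
    (v / (W * L)) % Kc ∈ Badκ ∨ v % (W * L) ∈ D := by
  by_contra h
  push Not at h
  apply hne
  rw [hcoin v h.1]
  -- `v % (W L) = E + W j` with `E = v % W`, `j = (v / W) % L`
  have hE : v % (W * L) % W = v % W := Nat.mod_mul_right_mod v W L
  have hj : v % (W * L) / W = (v / W) % L := Nat.mod_mul_right_div_self v W L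
  have hdecomp : v % (W * L) = v % W + W * ((v / W) % L) := by
    rw [← hE, ← hj]; exact (Nat.mod_add_div _ _).symm
  have hjL : (v / W) % L < L := Nat.mod_lt _ hL
  have hEW : v % W < W := Nat.mod_lt _ hW
  have hD : v % W + W * ((v / W) % L) ∉ D := by rw [← hdecomp]; exact h.2
  rw [hdecomp, hdef _ hEW _ hjL hD]
  congr 1
  rw [Nat.add_mod, Nat.mod_mod_of_dvd _ hSL, ← Nat.add_mod]

include hW hL hSL hcoin hdef in
/-- **The table and its idealisation differ on few positions**: at most `(εκ + εD)·(W L P)` of the `v < W L P` when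
`Kc ∣ P`, `#Badκ ≤ εκ Kc` and `#D ≤ εD W L`. [cite: Hallgren2005, §4] -/
theorem card_ne_idealised_le (hKc : 0 < Kc) (hKP : Kc ∣ P) {εκ εD : ℝ} (hBad : (Badκ.card : ℝ) ≤ εκ * Kc)
    (hDc : (D.card : ℝ) ≤ εD * (W * L : ℕ)) :
    ((((range (W * L * P)).filter (fun v => F v ≠ C (cls (v % W)) ((σ (v % W) + v / W) % S))).card : ℕ) : ℝ) ≤
      (εκ + εD) * (W * L * P : ℕ) := by
  obtain ⟨P', rfl⟩ := hKP
  have hWL : 0 < W * L := Nat.mul_pos hW hL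
  -- the two covering sets
  have hsub : (range (W * L * (Kc * P'))).filter (fun v => F v ≠ C (cls (v % W)) ((σ (v % W) + v / W) % S)) ⊆
      (range (W * L * (Kc * P'))).filter (fun v => (v / (W * L)) % Kc ∈ Badκ) ∪
        (range (W * L * (Kc * P'))).filter (fun v => v % (W * L) ∈ D) := by
    intro v hv
    obtain ⟨hvr, hne⟩ := mem_filter.1 hv
    rcases ne_idealised_imp hW hL hSL F F₀ cls σ C Badκ D hcoin hdef v hne with h | h
    · exact mem_union_left _ (mem_filter.2 ⟨hvr, h⟩)
    · exact mem_union_right _ (mem_filter.2 ⟨hvr, h⟩)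
  have hcoinCard : ((range (W * L * (Kc * P'))).filter (fun v => (v / (W * L)) % Kc ∈ Badκ)).card ≤
      W * L * (P' * Badκ.card) := by
    have h1 : ((range (W * L * (Kc * P'))).filter (fun v => (v / (W * L)) % Kc ∈ Badκ)).card =
        W * L * ((range (Kc * P')).filter (fun κ => κ % Kc ∈ Badκ)).card :=
      card_filter_div (W * L) (Kc * P') hWL (fun κ => κ % Kc ∈ Badκ)
    have h2 : ((range (Kc * P')).filter (fun κ => κ % Kc ∈ Badκ)).card ≤ P' * Badκ.card :=
      card_filter_mod_mem_le Kc P' hKc Badκ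
    rw [h1]
    exact Nat.mul_le_mul_left _ h2
  have hdefCard : ((range (W * L * (Kc * P'))).filter (fun v => v % (W * L) ∈ D)).card ≤ Kc * P' * D.card :=
    card_filter_mod_mem_le (W * L) (Kc * P') hWL D
  have hnat := (card_le_card hsub).trans ((card_union_le _ _).trans (Nat.add_le_add hcoinCard hdefCard))
  have hR : ((((range (W * L * (Kc * P'))).filter
      (fun v => F v ≠ C (cls (v % W)) ((σ (v % W) + v / W) % S))).card : ℕ) : ℝ) ≤
      (W * L * (P' * Badκ.card) + Kc * P' * D.card : ℕ) := by exact_mod_cast hnat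
  refine hR.trans ?_
  push_cast
  have h1 : (W : ℝ) * L * (P' * Badκ.card) ≤ εκ * (W * L * (Kc * P')) := by
    have : (W : ℝ) * L * P' * Badκ.card ≤ (W : ℝ) * L * P' * (εκ * Kc) :=
      mul_le_mul_of_nonneg_left hBad (by positivity)
    linarith
  have h2 : (Kc : ℝ) * P' * D.card ≤ εD * (W * L * (Kc * P')) := by
    push_cast at hDc
    have : (Kc : ℝ) * P' * D.card ≤ (Kc : ℝ) * P' * (εD * (W * L)) := mul_le_mul_of_nonneg_left hDc (by positivity)
    linarith
  linarith

end Ideal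

/-- **The autocorrelation laws of the table and of its idealisation are close**:
`∑_{c<Q} |corrMass Q F c − corrMass Q F₁ c| ≤ 2Q²√(2(εκ+εD))`, `Q = W L P`. [cite: Hallgren2005, §4] -/
theorem sum_abs_corrMass_sub_idealised_le : ∀ {Ω : Type*} [DecidableEq Ω] {W L P Kc S : ℕ}, 0 < W → 0 < L → S ∣ L →
    ∀ (F F₀ : ℕ → Ω) (cls σ : ℕ → ℕ) (C : ℕ → ℕ → Ω) (Badκ D : Finset ℕ),
    (∀ v : ℕ, (v / (W * L)) % Kc ∉ Badκ → F v = F₀ (v % (W * L))) →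
    (∀ E < W, ∀ j < L, E + W * j ∉ D → F₀ (E + W * j) = C (cls E) ((σ E + j) % S)) →
    0 < Kc → Kc ∣ P → 0 < P → ∀ {εκ εD : ℝ}, (Badκ.card : ℝ) ≤ εκ * Kc → (D.card : ℝ) ≤ εD * (W * L : ℕ) →
    ∑ c ∈ Finset.range (W * L * P), |corrMass (W * L * P) F c -
        corrMass (W * L * P) (fun v => C (cls (v % W)) ((σ (v % W) + v / W) % S)) c| ≤
      2 * ((W * L * P : ℕ) : ℝ) ^ 2 * Real.sqrt (2 * (εκ + εD)) := by
  intro Ω _ W L P Kc S hW hL hSL F F₀ cls σ C Badκ D hcoin hdef hKc hKP hP εκ εD hBad hDc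
  have hQ : 0 < W * L * P := Nat.mul_pos (Nat.mul_pos hW hL) hP
  have hQR : (0 : ℝ) < ((W * L * P : ℕ) : ℝ) := by exact_mod_cast hQ
  refine (sum_abs_corrMass_sub_le (W * L * P) hQ F _).trans ?_
  have hcard := card_ne_idealised_le hW hL hSL F F₀ cls σ C Badκ D hcoin hdef hKc hKP hBad hDc
  gcongr
  rw [div_le_iff₀ hQR]
  linarith

omit [DecidableEq Ω] in
/-- **The idealised table is an exact shift-cell table** on any number of periods. [folklore] -/
theorem idealised_shiftCell {W S : ℕ} (hW : 0 < W) (cls σ : ℕ → ℕ) (C : ℕ → ℕ → Ω) (E : ℕ) (hE : E < W) (j : ℕ) :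
    (fun v => C (cls (v % W)) ((σ (v % W) + v / W) % S)) (E + W * j) = C (cls E) ((σ E + j) % S) := by
  simp only [Nat.add_mul_mod_self_left, Nat.mod_eq_of_lt hE, Nat.add_mul_div_left _ _ hW, Nat.div_eq_of_lt hE,
    zero_add]

/-! ### Reindexing the characters -/

/-- **A weight vanishing off the multiples of `a`**: its sum over the `c < a·N` satisfying `P` is the sum over the
`k < N` with `P (a k)`. [folklore] -/
theorem sum_filter_range_mul_eq {a N : ℕ} (ha : 0 < a) (P : ℕ → Prop) [DecidablePred P] (f : ℕ → ℝ)
    (hf : ∀ c < a * N, ¬ a ∣ c → f c = 0) :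
    ∑ c ∈ (range (a * N)).filter P, f c = ∑ k ∈ (range N).filter (fun k => P (a * k)), f (a * k) := by
  rw [sum_filter, sum_filter]
  -- split `range (a N)` along the multiples of `a`
  rw [← sum_filter_add_sum_filter_not (range (a * N)) (fun c => a ∣ c)]
  have hzero : ∑ c ∈ (range (a * N)).filter (fun c => ¬ a ∣ c), (if P c then f c else 0) = 0 := by
    refine sum_eq_zero fun c hc => ?_
    obtain ⟨hcr, hnd⟩ := mem_filter.1 hc
    rw [hf c (mem_range.1 hcr) hnd, ite_self]
  rw [hzero, add_zero]
  have himage : (range (a * N)).filter (fun c => a ∣ c) = (range N).image (fun k => a * k) := by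
    ext c
    simp only [mem_filter, mem_range, mem_image]
    constructor
    · rintro ⟨hc, k, rfl⟩
      exact ⟨k, by nlinarith, rfl⟩
    · rintro ⟨k, hk, rfl⟩
      exact ⟨by nlinarith, k, rfl⟩
  rw [himage, sum_image fun k _ k' _ h => Nat.eq_of_mul_eq_mul_left ha h]

/-- **Slices**: a sum over the `k < S·W` satisfying `P` is the double sum over `ν < W`, `k₀ < S` of the terms with
`P (k₀ + S ν)`. [folklore] -/
theorem sum_filter_range_mul_eq_sum_sum {S W : ℕ} (P : ℕ → Prop) [DecidablePred P] (f : ℕ → ℝ) :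
    ∑ k ∈ (range (S * W)).filter P, f k = ∑ ν ∈ range W, ∑ k₀ ∈ (range S).filter (fun k₀ => P (k₀ + S * ν)), f (k₀ + S * ν) := by
  rw [sum_filter, sum_range_mul_blocks S W]
  exact sum_congr rfl fun ν _ => by rw [sum_filter]

end PeriodFinding

end Literature.Computability.Cryptography
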